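import Summits.Ventures.Crystal3D.Theorems.StickyWulffConstantCoaxialWallLawLayered
import Summits.Ventures.Crystal3D.Theorems.StickyWulffConstantCoaxialWallLawOffSiteLocal
import HarnessLib

/-!
# The off-site budget of `stub_coaxialTwoSlabAdhesion`: the stub for ARBITRARY fillings up to half the on-site/off-site contacts

HONEST FRAMING. Part of the venture `Summits/Ventures/Crystal3D` (cell `crystal3d-full`), helper
`--supports` the crux `CoaxialWallLaw` (stmt-Ventures-19481, `route-Ventures-StickyWulffConstant`),
REGISTERED line `WallLedgerF` (planner cf-p1 gen 16), open stub `stub_coaxialTwoSlabAdhesion`.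
RUNG CREDIT ONLY; F-C1 not moved.  Planner programme (xxix): after the LAYERED rung
(`…CoaxialWallLawLayered.coaxialTwoSlabAdhesion_layered`: the stub VERBATIM for fillings on the co-axial
site lattice), (F-loc)/(F-off) ask what an ARBITRARY filling must spend OFF the site lattice to beat the charge.

**Theorem (`coaxialTwoSlabAdhesion_offSite`).**  For the crux's frame data `(L, s₁, s₂, σ, σ')`, `Λ₁ ≠ Λ₂`,
there are `C`, `R₀ = 10` such that for EVERY filling of the stub's cell (`X` `1`-separated, clamped samples
complete — NOTHING else):

  `cross(P₁, X∖P₁) + cross(P₂, Y) ≤ D(Y) + (φ₁ + φ₂ − (√6/3)·√(1 − ⟪L e₃, e₃⟫²)) π ρ² + C (1 + h) ρ + ½·B_on/off`,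

where `B_on/off = Σ_z #{q ∈ X : |q − z| = 1, q off-site}`, the sum over the on-site window balls `z`
(`−R₀−2 ≤ z₂ ≤ h+R₀+2`) WITH A VACANT IN-PLANE SITE (`z + d ∉ X` for some `d ∈ SIX(L)`: balls at a 2D defect
of their own layer — riser balls), counts the off-site contacts of such balls («site» = point of
`L(ℤu₁ + ℤu₂ + ℤw + ℤν) + s₁`).  For an
on-site filling `B_on/off = 0` and this is `coaxialTwoSlabAdhesion_layered_sharp` again; in general it says: a
filling that beats the charge `c·sin θ` MUST carry at least `2(√6/3 − c)·sin θ·πρ² − O((1+h)ρ)` on-site/off-site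
contacts at the wall (so `≥ (√6/3 − c)/6 · sin θ · πρ²` off-site balls there, each having `≤ 12` contacts) —
the off-site residual of lane F made quantitative.  Proof = the layered rung's with the local law replaced by
`…OffSiteLocal.onSite_card_contacts_add_vacant_le` (vacant in-plane sites of an on-site ball are missing
contacts of that ball up to its off-site contacts) and the payer assembly carrying a budget term
(`twoSlab_cross_le_of_deficit_budget`).  Inputs: none (no kissing facts, no census).

* `twoSlab_cross_le_of_deficit_budget` — `…PayerAssembly.twoSlab_cross_le_of_deficit` with an extra budget `E`.
* `site_of_mem_coaxialGrain` — balls of `Λ₁` are sites of `(L, s₁)`.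

WHAT THIS IS NOT: no bound on `B_on/off` (that is the riser-core census / line-A localisation); F-C1 not moved.
-/

noncomputable section

namespace Summit.Ventures.Crystal3D.Theorems

open Summit.Ventures.Crystal3D Finset
open Literature.MathematicalPhysics.StatisticalMechanics (fccStacking barlowStacking barlowPos IsHaggSeq
  haggLabel contactDeficiency triangularVec₁ triangularVec₂ barlowOffset layerNormal)
open scoped InnerProductSpace

/-! ## The payer assembly with a budget -/

open scoped Classical in
/-- **The payer assembly, deficit form with a budget `E`.**  Verbatim `twoSlab_cross_le_of_deficit` with the
payer bound weakened by `E` and the conclusion by `E/2`. -/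
theorem twoSlab_cross_le_of_deficit_budget
    (A₁ : EuclideanSpace ℝ (Fin 3) ≃ₗᵢ[ℝ] EuclideanSpace ℝ (Fin 3)) (t₁ : EuclideanSpace ℝ (Fin 3))
    (A₂ : EuclideanSpace ℝ (Fin 3) ≃ₗᵢ[ℝ] EuclideanSpace ℝ (Fin 3)) (t₂ : EuclideanSpace ℝ (Fin 3))
    (R₀ : ℝ) (hR₀ : 10 ≤ R₀) :
    ∃ C : ℝ, ∀ h : ℝ, 0 ≤ h → ∀ ρ : ℝ, R₀ ≤ ρ →
      ∀ X P₁ P₂ : Finset (EuclideanSpace ℝ (Fin 3)),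
      (∀ p ∈ X, ∀ q ∈ X, p ≠ q → 1 ≤ dist p q) → P₁ ⊆ X → P₂ ⊆ X \ P₁ →
      (∀ p ∈ X, -(2 * R₀) ≤ p 2 ∧ p 2 ≤ h + 2 * R₀ ∧ p 0 ^ 2 + p 1 ^ 2 ≤ ρ ^ 2) →
      (∀ p, p ∈ P₁ ↔ (p ∈ (fun q => A₁ q + t₁) '' fccStacking 1 (Real.sqrt (2 / 3)) ∧
        -(2 * R₀) ≤ p 2 ∧ p 2 ≤ -R₀ ∧ p 0 ^ 2 + p 1 ^ 2 ≤ ρ ^ 2)) →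
      (∀ p, p ∈ P₂ ↔ (p ∈ (fun q => A₂ q + t₂) '' fccStacking 1 (Real.sqrt (2 / 3)) ∧
        h + R₀ ≤ p 2 ∧ p 2 ≤ h + 2 * R₀ ∧ p 0 ^ 2 + p 1 ^ 2 ≤ ρ ^ 2)) →
      ∀ c C₀ E : ℝ, 0 ≤ C₀ →
      c * Real.pi * ρ ^ 2 - C₀ * (1 + h) * ρ - E ≤
        ∑ z ∈ X.filter (fun z => -R₀ - 2 ≤ z 2 ∧ z 2 ≤ h + R₀ + 2),
          ((12 : ℝ) - ((X.filter fun q => dist z q = 1).card : ℝ)) →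
      ((((P₁ ×ˢ (X \ P₁)).filter fun pq => dist pq.1 pq.2 = 1).card : ℕ) : ℝ) +
        ((((P₂ ×ˢ ((X \ P₁) \ P₂)).filter fun pq => dist pq.1 pq.2 = 1).card : ℕ) : ℝ) ≤
        contactDeficiency ((X \ P₁) \ P₂) +
          (Real.sqrt 2 / 4 * ∑ᶠ w ∈ {w ∈ fccStacking 1 (Real.sqrt (2 / 3)) | ‖w‖ = 1},
              |⟪w, A₁.symm (EuclideanSpace.single (2 : Fin 3) (1 : ℝ))⟫_ℝ| +
            Real.sqrt 2 / 4 * ∑ᶠ w ∈ {w ∈ fccStacking 1 (Real.sqrt (2 / 3)) | ‖w‖ = 1},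
              |⟪w, A₂.symm (EuclideanSpace.single (2 : Fin 3) (1 : ℝ))⟫_ℝ| - c / 2) * Real.pi * ρ ^ 2 +
          (C + C₀ / 2) * (1 + h) * ρ + E / 2 := by
  obtain ⟨C, hC⟩ := twoSlab_cross_le_of_deficit A₁ t₁ A₂ t₂ R₀ hR₀
  refine ⟨C, ?_⟩
  intro h hh ρ hρ X P₁ P₂ hX hP₁X hP₂X₁ hcyl hP₁ hP₂ c C₀ E hC₀ hpay
  have hρ0 : (0 : ℝ) < ρ := by linarith
  have hπρ : 0 < Real.pi * ρ ^ 2 := by positivity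
  -- absorb the budget into the charge: `c' = c − E/(π ρ²)`
  set c' : ℝ := c - E / (Real.pi * ρ ^ 2) with hc'
  have hpay' : c' * Real.pi * ρ ^ 2 - C₀ * (1 + h) * ρ ≤
      ∑ z ∈ X.filter (fun z => -R₀ - 2 ≤ z 2 ∧ z 2 ≤ h + R₀ + 2),
        ((12 : ℝ) - ((X.filter fun q => dist z q = 1).card : ℝ)) := by
    have e : c' * Real.pi * ρ ^ 2 = c * Real.pi * ρ ^ 2 - E := by
      rw [hc']; field_simp
    linarith [hpay, e]
  have hfin := hC h hh ρ hρ X P₁ P₂ hX hP₁X hP₂X₁ hcyl hP₁ hP₂ c' C₀ hC₀ hpay'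
  have e2 : (c' / 2) * Real.pi * ρ ^ 2 = (c / 2) * Real.pi * ρ ^ 2 - E / 2 := by
    rw [hc']; field_simp
  nlinarith [hfin, e2]

/-! ## Grain balls are sites -/

/-- **Balls of a co-axial grain are sites of its frame.** -/
theorem site_of_mem_coaxialGrain
    (A : EuclideanSpace ℝ (Fin 3) ≃ₗᵢ[ℝ] EuclideanSpace ℝ (Fin 3)) (t : EuclideanSpace ℝ (Fin 3))
    (L : EuclideanSpace ℝ (Fin 3) ≃ₗᵢ[ℝ] EuclideanSpace ℝ (Fin 3)) (s : EuclideanSpace ℝ (Fin 3))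
    {σ : ℤ → ℤ}
    (hsub : (fun p => A p + t) '' fccStacking 1 (Real.sqrt (2 / 3)) ⊆
      (fun p => L p + s) '' barlowStacking 1 (Real.sqrt (2 / 3)) σ) :
    ∀ p ∈ (fun p => A p + t) '' fccStacking 1 (Real.sqrt (2 / 3)),
      ∃ i j c k : ℤ, p = L ((i : ℝ) • triangularVec₁ (1 : ℝ) + (j : ℝ) • triangularVec₂ (1 : ℝ) +
        (c : ℝ) • barlowOffset (1 : ℝ) + (k : ℝ) • layerNormal (Real.sqrt (2 / 3))) + s := by
  intro p hp
  obtain ⟨q, ⟨k, i, j, rfl⟩, rfl⟩ := hsub hp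
  refine ⟨i, j, haggLabel σ k, k, ?_⟩
  show L (barlowPos 1 (Real.sqrt (2 / 3)) σ k i j) + s = _
  rw [barlowPos_eq_combo]

/-! ## The off-site budget law -/

open scoped Classical in
/-- **The OFF-SITE BUDGET law of `stub_coaxialTwoSlabAdhesion`** (ARBITRARY fillings, constant `√6/3`, explicit
frame): the stub's inequality up to half the number of on-site/off-site contact pairs at window balls.  See the
module docstring. -/
theorem coaxialTwoSlabAdhesion_offSite
    (A₁ : EuclideanSpace ℝ (Fin 3) ≃ₗᵢ[ℝ] EuclideanSpace ℝ (Fin 3)) (t₁ : EuclideanSpace ℝ (Fin 3))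
    (A₂ : EuclideanSpace ℝ (Fin 3) ≃ₗᵢ[ℝ] EuclideanSpace ℝ (Fin 3)) (t₂ : EuclideanSpace ℝ (Fin 3))
    (L : EuclideanSpace ℝ (Fin 3) ≃ₗᵢ[ℝ] EuclideanSpace ℝ (Fin 3)) (s₁ s₂ : EuclideanSpace ℝ (Fin 3))
    {σ σ' : ℤ → ℤ} (hσ : IsHaggSeq σ) (hσ' : IsHaggSeq σ')
    (hsub₁ : (fun p => A₁ p + t₁) '' fccStacking 1 (Real.sqrt (2 / 3)) ⊆
      (fun p => L p + s₁) '' barlowStacking 1 (Real.sqrt (2 / 3)) σ)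
    (hsub₂ : (fun p => A₂ p + t₂) '' fccStacking 1 (Real.sqrt (2 / 3)) ⊆
      (fun p => L p + s₂) '' barlowStacking 1 (Real.sqrt (2 / 3)) σ')
    (hne : (fun p => A₁ p + t₁) '' fccStacking 1 (Real.sqrt (2 / 3)) ≠
      (fun p => A₂ p + t₂) '' fccStacking 1 (Real.sqrt (2 / 3))) :
    ∃ C R₀ : ℝ, 1 ≤ R₀ ∧ ∀ h : ℝ, 0 ≤ h → ∀ ρ : ℝ, R₀ ≤ ρ →
      ∀ X P₁ P₂ : Finset (EuclideanSpace ℝ (Fin 3)),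
      (∀ p ∈ X, ∀ q ∈ X, p ≠ q → 1 ≤ dist p q) → P₁ ⊆ X → P₂ ⊆ X \ P₁ →
      (∀ p ∈ X, -(2 * R₀) ≤ p 2 ∧ p 2 ≤ h + 2 * R₀ ∧ p 0 ^ 2 + p 1 ^ 2 ≤ ρ ^ 2) →
      (∀ p, p ∈ P₁ ↔ (p ∈ (fun q => A₁ q + t₁) '' fccStacking 1 (Real.sqrt (2 / 3)) ∧
        -(2 * R₀) ≤ p 2 ∧ p 2 ≤ -R₀ ∧ p 0 ^ 2 + p 1 ^ 2 ≤ ρ ^ 2)) →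
      (∀ p, p ∈ P₂ ↔ (p ∈ (fun q => A₂ q + t₂) '' fccStacking 1 (Real.sqrt (2 / 3)) ∧
        h + R₀ ≤ p 2 ∧ p 2 ≤ h + 2 * R₀ ∧ p 0 ^ 2 + p 1 ^ 2 ≤ ρ ^ 2)) →
      ((((P₁ ×ˢ (X \ P₁)).filter fun pq => dist pq.1 pq.2 = 1).card : ℕ) : ℝ) +
        ((((P₂ ×ˢ ((X \ P₁) \ P₂)).filter fun pq => dist pq.1 pq.2 = 1).card : ℕ) : ℝ) ≤
        contactDeficiency ((X \ P₁) \ P₂) +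
          (Real.sqrt 2 / 4 * ∑ᶠ w ∈ {w ∈ fccStacking 1 (Real.sqrt (2 / 3)) | ‖w‖ = 1},
              |⟪w, A₁.symm (EuclideanSpace.single (2 : Fin 3) (1 : ℝ))⟫_ℝ| +
            Real.sqrt 2 / 4 * ∑ᶠ w ∈ {w ∈ fccStacking 1 (Real.sqrt (2 / 3)) | ‖w‖ = 1},
              |⟪w, A₂.symm (EuclideanSpace.single (2 : Fin 3) (1 : ℝ))⟫_ℝ| -
            (Real.sqrt 6 / 3 : ℝ) * Real.sqrt (1 - ⟪L (EuclideanSpace.single (2 : Fin 3) (1 : ℝ)),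
              (EuclideanSpace.single (2 : Fin 3) (1 : ℝ))⟫_ℝ ^ 2)) * Real.pi * ρ ^ 2 +
          C * (1 + h) * ρ +
          1 / 2 * ∑ z ∈ X.filter (fun z => (-R₀ - 2 ≤ z 2 ∧ z 2 ≤ h + R₀ + 2) ∧
              (∃ i j c k : ℤ, z = L ((i : ℝ) • triangularVec₁ (1 : ℝ) + (j : ℝ) • triangularVec₂ (1 : ℝ) +
                (c : ℝ) • barlowOffset (1 : ℝ) + (k : ℝ) • layerNormal (Real.sqrt (2 / 3))) + s₁) ∧
              ∃ d ∈ ({L (triangularVec₁ 1), -L (triangularVec₁ 1), L (triangularVec₂ 1), -L (triangularVec₂ 1),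
                  L (triangularVec₂ 1 - triangularVec₁ 1), -L (triangularVec₂ 1 - triangularVec₁ 1)} :
                  Finset (EuclideanSpace ℝ (Fin 3))), z + d ∉ X),
            ((X.filter fun q => dist z q = 1 ∧ ¬ ∃ i j c k : ℤ, q = L ((i : ℝ) • triangularVec₁ (1 : ℝ) +
              (j : ℝ) • triangularVec₂ (1 : ℝ) + (c : ℝ) • barlowOffset (1 : ℝ) +
              (k : ℝ) • layerNormal (Real.sqrt (2 / 3))) + s₁).card : ℝ) := by
  set e₃ : EuclideanSpace ℝ (Fin 3) := EuclideanSpace.single (2 : Fin 3) (1 : ℝ) with he₃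
  set s : ℝ := Real.sqrt (1 - ⟪L e₃, e₃⟫_ℝ ^ 2) with hs
  have hs0 : 0 ≤ s := Real.sqrt_nonneg _
  obtain ⟨Cpa, hCpa⟩ := twoSlab_cross_le_of_deficit_budget A₁ t₁ A₂ t₂ 10 (by norm_num)
  set C₀ : ℝ := 3 * (12 * Real.sqrt 2 * Real.pi + 72 * 10) with hC₀
  have hC₀0 : 0 ≤ C₀ := by positivity
  -- the three signed in-plane classes as non-descending slots of grain 1
  obtain ⟨hn₁, hn₂, hn₁₂⟩ := norm_triangularVec_one
  have hv₁ : (((1 : ℤ) : ℝ)) • triangularVec₁ (1 : ℝ) + (((0 : ℤ) : ℝ)) • triangularVec₂ (1 : ℝ) =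
      triangularVec₁ 1 := by simp
  have hv₂ : (((0 : ℤ) : ℝ)) • triangularVec₁ (1 : ℝ) + (((1 : ℤ) : ℝ)) • triangularVec₂ (1 : ℝ) =
      triangularVec₂ 1 := by simp
  have hv₃ : (((-1 : ℤ) : ℝ)) • triangularVec₁ (1 : ℝ) + (((1 : ℤ) : ℝ)) • triangularVec₂ (1 : ℝ) =
      triangularVec₂ 1 - triangularVec₁ 1 := by push_cast; module
  obtain ⟨ε₁, hε₁, w₁, hw₁, hA₁, hup₁⟩ := exists_up_slot_of_inPlane_class A₁ t₁ L s₁ hσ hsub₁ 1 0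
    (by rw [hv₁]; exact hn₁)
  obtain ⟨ε₂, hε₂, w₂, hw₂, hA₂, hup₂⟩ := exists_up_slot_of_inPlane_class A₁ t₁ L s₁ hσ hsub₁ 0 1
    (by rw [hv₂]; exact hn₂)
  obtain ⟨ε₃, hε₃, w₃, hw₃, hA₃, hup₃⟩ := exists_up_slot_of_inPlane_class A₁ t₁ L s₁ hσ hsub₁ (-1) 1
    (by rw [hv₃]; exact hn₁₂)
  refine ⟨Cpa + C₀ / 2, 10, by norm_num, ?_⟩
  intro h hh ρ hρ X P₁ P₂ hX hP₁X hP₂X₁ hcell hP₁ hP₂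
  have hP₂X : P₂ ⊆ X := hP₂X₁.trans sdiff_subset
  have hρ0 : (0 : ℝ) ≤ ρ := by linarith
  -- the three located run-end counts
  have hE₁ := card_inPlane_runEnds_ge_coaxial A₁ t₁ A₂ t₂ L s₁ s₂ hσ hσ' hsub₁ hsub₂ hne X P₁ P₂ 10 h ρ le_rfl hρ
    hX hcell hP₁X hP₂X hP₁ hP₂ hw₁ hup₁ hε₁ 1 0 hA₁
  have hE₂ := card_inPlane_runEnds_ge_coaxial A₁ t₁ A₂ t₂ L s₁ s₂ hσ hσ' hsub₁ hsub₂ hne X P₁ P₂ 10 h ρ le_rfl hρ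
    hX hcell hP₁X hP₂X hP₁ hP₂ hw₂ hup₂ hε₂ 0 1 hA₂
  have hE₃ := card_inPlane_runEnds_ge_coaxial A₁ t₁ A₂ t₂ L s₁ s₂ hσ hσ' hsub₁ hsub₂ hne X P₁ P₂ 10 h ρ le_rfl hρ
    hX hcell hP₁X hP₂X hP₁ hP₂ hw₃ hup₃ hε₃ (-1) 1 hA₃
  rw [hv₁] at hA₁
  rw [hv₂] at hA₂
  rw [hv₃] at hA₃
  -- the fluxes of the three classes carry the sine
  have habs : ∀ {ε : ℝ} (v : EuclideanSpace ℝ (Fin 3)), (ε = 1 ∨ ε = -1) →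
      |⟪L (ε • v), e₃⟫_ℝ| = |⟪L v, e₃⟫_ℝ| := by
    intro ε v hε
    rcases hε with rfl | rfl
    · rw [one_smul]
    · rw [neg_one_smul, map_neg, inner_neg_left, abs_neg]
  have hflux : Real.sqrt 6 * s ≤ Real.sqrt 2 * (|⟪A₁ w₁, e₃⟫_ℝ| + |⟪A₁ w₂, e₃⟫_ℝ| + |⟪A₁ w₃, e₃⟫_ℝ|) := by
    rw [hA₁, hA₂, hA₃, habs _ hε₁, habs _ hε₂, habs _ hε₃]
    exact coaxial_sine_le_inPlaneClasses L
  -- the window sum, its on-site part, and the local law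
  set XwinAll := X.filter fun z => -(10 : ℝ) - 2 ≤ z 2 ∧ z 2 ≤ h + 10 + 2 with hXwinAll
  set SIX : Finset (EuclideanSpace ℝ (Fin 3)) := {L (triangularVec₁ 1), -L (triangularVec₁ 1),
    L (triangularVec₂ 1), -L (triangularVec₂ 1), L (triangularVec₂ 1 - triangularVec₁ 1),
    -L (triangularVec₂ 1 - triangularVec₁ 1)} with hSIX
  set Xwin := X.filter (fun z => (-(10 : ℝ) - 2 ≤ z 2 ∧ z 2 ≤ h + 10 + 2) ∧
    (∃ i j c k : ℤ, z = L ((i : ℝ) • triangularVec₁ (1 : ℝ) + (j : ℝ) • triangularVec₂ (1 : ℝ) +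
      (c : ℝ) • barlowOffset (1 : ℝ) + (k : ℝ) • layerNormal (Real.sqrt (2 / 3))) + s₁) ∧
    ∃ d ∈ SIX, z + d ∉ X) with hXwin
  set off : EuclideanSpace ℝ (Fin 3) → ℕ := fun z => (X.filter fun q => dist z q = 1 ∧ ¬ ∃ i j c k : ℤ,
    q = L ((i : ℝ) • triangularVec₁ (1 : ℝ) + (j : ℝ) • triangularVec₂ (1 : ℝ) + (c : ℝ) • barlowOffset (1 : ℝ) +
      (k : ℝ) • layerNormal (Real.sqrt (2 / 3))) + s₁).card with hoff
  have hloc : ∀ z ∈ Xwin, ((SIX.filter fun d => z + d ∉ X).card : ℝ) ≤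
      (12 : ℝ) - ((X.filter fun q => dist z q = 1).card : ℝ) + (off z : ℝ) := by
    intro z hz
    have hzsite := (mem_filter.1 hz).2.2.1
    have h := onSite_card_contacts_add_vacant_le L s₁ X hX hzsite
    have h' : (((X.filter fun q => dist z q = 1).card : ℕ) : ℝ) +
        (((SIX.filter fun d => z + d ∉ X).card : ℕ) : ℝ) ≤ 12 + (off z : ℝ) := by
      rw [hoff]; exact_mod_cast h
    linarith
  -- swap the double count
  have hswap : ∑ z ∈ Xwin, (SIX.filter fun d => z + d ∉ X).card =
      ∑ d ∈ SIX, (Xwin.filter fun z => z + d ∉ X).card := by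
    rw [Finset.sum_congr rfl (fun z _ => Finset.card_filter (fun d => z + d ∉ X) SIX), Finset.sum_comm]
    refine sum_congr rfl fun d _ => ?_
    rw [Finset.card_filter]
  -- the three classes inside the six, pairwise distinct
  have hmem : ∀ {ε : ℝ} (v : EuclideanSpace ℝ (Fin 3)), (ε = 1 ∨ ε = -1) → (L v ∈ SIX ∧ -L v ∈ SIX) →
      L (ε • v) ∈ SIX := by
    intro ε v hε hv
    rcases hε with rfl | rfl
    · rw [one_smul]; exact hv.1
    · rw [neg_one_smul, map_neg]; exact hv.2
  have hd₁m : A₁ w₁ ∈ SIX := by rw [hA₁]; exact hmem _ hε₁ (by simp [hSIX])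
  have hd₂m : A₁ w₂ ∈ SIX := by rw [hA₂]; exact hmem _ hε₂ (by simp [hSIX])
  have hd₃m : A₁ w₃ ∈ SIX := by rw [hA₃]; exact hmem _ hε₃ (by simp [hSIX])
  obtain ⟨h12, -, -⟩ := inPlane_classes_ne hε₁ hε₂
  obtain ⟨-, h13, -⟩ := inPlane_classes_ne hε₁ hε₃
  obtain ⟨-, -, h23⟩ := inPlane_classes_ne hε₂ hε₃
  have hne12 : A₁ w₁ ≠ A₁ w₂ := by rw [hA₁, hA₂]; exact fun h => h12 (L.injective h)
  have hne13 : A₁ w₁ ≠ A₁ w₃ := by rw [hA₁, hA₃]; exact fun h => h13 (L.injective h)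
  have hne23 : A₁ w₂ ≠ A₁ w₃ := by rw [hA₂, hA₃]; exact fun h => h23 (L.injective h)
  have hsub3 : ({A₁ w₁, A₁ w₂, A₁ w₃} : Finset (EuclideanSpace ℝ (Fin 3))) ⊆ SIX := by
    intro d hd
    simp only [mem_insert, mem_singleton] at hd
    rcases hd with rfl | rfl | rfl
    · exact hd₁m
    · exact hd₂m
    · exact hd₃m
  have hthree : ∑ d ∈ ({A₁ w₁, A₁ w₂, A₁ w₃} : Finset (EuclideanSpace ℝ (Fin 3))),
      (Xwin.filter fun z => z + d ∉ X).card =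
      (Xwin.filter fun z => z + A₁ w₁ ∉ X).card + (Xwin.filter fun z => z + A₁ w₂ ∉ X).card +
        (Xwin.filter fun z => z + A₁ w₃ ∉ X).card := by
    rw [sum_insert (by simp [hne12, hne13]), sum_insert (by simp [hne23]), sum_singleton]
    ring
  have hsub_sum : ∑ d ∈ ({A₁ w₁, A₁ w₂, A₁ w₃} : Finset (EuclideanSpace ℝ (Fin 3))),
      (Xwin.filter fun z => z + d ∉ X).card ≤ ∑ d ∈ SIX, (Xwin.filter fun z => z + d ∉ X).card :=
    sum_le_sum_of_subset_of_nonneg hsub3 (fun _ _ _ => Nat.zero_le _)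
  -- located ends are on-site window balls with a vacant in-plane site
  have hsite₁ := site_of_mem_coaxialGrain A₁ t₁ L s₁ hsub₁
  have hEsub : ∀ d ∈ SIX,
      (X.filter fun e => e ∈ (fun q => A₁ q + t₁) '' fccStacking 1 (Real.sqrt (2 / 3)) ∧
        e ∉ (fun q => A₂ q + t₂) '' fccStacking 1 (Real.sqrt (2 / 3)) ∧ e + d ∉ X ∧
        -(10 : ℝ) - 2 ≤ e 2 ∧ e 2 ≤ h + 10 + 2).card ≤ (Xwin.filter fun z => z + d ∉ X).card := by
    intro d hd
    refine card_le_card ?_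
    intro e he
    rw [mem_filter] at he
    rw [mem_filter, hXwin, mem_filter]
    exact ⟨⟨he.1, ⟨he.2.2.2.2.1, he.2.2.2.2.2⟩, hsite₁ e he.2.1, d, hd, he.2.2.2.1⟩, he.2.2.2.1⟩
  -- assemble the payer bound
  set S : ℝ := ∑ z ∈ XwinAll, ((12 : ℝ) - ((X.filter fun q => dist z q = 1).card : ℝ)) with hS
  set B : ℝ := ∑ z ∈ Xwin, (off z : ℝ) with hB
  have hSsub : ∑ z ∈ Xwin, ((12 : ℝ) - ((X.filter fun q => dist z q = 1).card : ℝ)) ≤ S := by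
    refine sum_le_sum_of_subset_of_nonneg ?_ ?_
    · intro z hz
      rw [hXwin, mem_filter] at hz
      rw [hXwinAll, mem_filter]
      exact ⟨hz.1, hz.2.1⟩
    · intro z hz _
      have := card_filter_dist_eq_one_le_twelve X hX z
      have h' : (((X.filter fun q => dist z q = 1).card : ℕ) : ℝ) ≤ 12 := by exact_mod_cast this
      linarith
  have hS_ge : (((Xwin.filter fun z => z + A₁ w₁ ∉ X).card : ℕ) : ℝ) +
      (((Xwin.filter fun z => z + A₁ w₂ ∉ X).card : ℕ) : ℝ) +
      (((Xwin.filter fun z => z + A₁ w₃ ∉ X).card : ℕ) : ℝ) - B ≤ S := by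
    have h1 : (∑ z ∈ Xwin, ((SIX.filter fun d => z + d ∉ X).card : ℝ)) ≤
        ∑ z ∈ Xwin, (((12 : ℝ) - ((X.filter fun q => dist z q = 1).card : ℝ)) + (off z : ℝ)) :=
      sum_le_sum hloc
    rw [sum_add_distrib] at h1
    have h2 : ((∑ d ∈ ({A₁ w₁, A₁ w₂, A₁ w₃} : Finset (EuclideanSpace ℝ (Fin 3))),
        (Xwin.filter fun z => z + d ∉ X).card : ℕ) : ℝ) ≤
        ((∑ d ∈ SIX, (Xwin.filter fun z => z + d ∉ X).card : ℕ) : ℝ) := by exact_mod_cast hsub_sum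
    rw [hthree] at h2
    rw [← hswap] at h2
    push_cast at h1 h2
    linarith [hSsub]
  have hE₁' := hE₁.trans (Nat.cast_le.2 (hEsub (A₁ w₁) hd₁m))
  have hE₂' := hE₂.trans (Nat.cast_le.2 (hEsub (A₁ w₂) hd₂m))
  have hE₃' := hE₃.trans (Nat.cast_le.2 (hEsub (A₁ w₃) hd₃m))
  have hpay : (2 / 3 * Real.sqrt 6 * s) * Real.pi * ρ ^ 2 - C₀ * (1 + h) * ρ - B ≤ S := by
    set a₁ := |⟪A₁ w₁, e₃⟫_ℝ| with ha₁
    set a₂ := |⟪A₁ w₂, e₃⟫_ℝ| with ha₂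
    set a₃ := |⟪A₁ w₃, e₃⟫_ℝ| with ha₃
    set Q : ℝ := Real.sqrt 2 * Real.pi * ρ ^ 2 with hQ
    have hQ0 : 0 ≤ Q := by positivity
    have e₁ : 2 / 3 * Real.sqrt 2 * a₁ * Real.pi * ρ ^ 2 = 2 / 3 * a₁ * Q := by rw [hQ]; ring
    have e₂ : 2 / 3 * Real.sqrt 2 * a₂ * Real.pi * ρ ^ 2 = 2 / 3 * a₂ * Q := by rw [hQ]; ring
    have e₃' : 2 / 3 * Real.sqrt 2 * a₃ * Real.pi * ρ ^ 2 = 2 / 3 * a₃ * Q := by rw [hQ]; ring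
    rw [e₁] at hE₁'
    rw [e₂] at hE₂'
    rw [e₃'] at hE₃'
    have hsum : 2 / 3 * (a₁ + a₂ + a₃) * Q - C₀ * ρ - B ≤ S := by
      have eC : C₀ * ρ = 3 * ((12 * Real.sqrt 2 * Real.pi + 72 * 10) * ρ) := by rw [hC₀]; ring
      rw [eC]
      linarith [hE₁', hE₂', hE₃', hS_ge]
    have h1 : Real.sqrt 6 * s * (Real.pi * ρ ^ 2) ≤ (a₁ + a₂ + a₃) * Q := by
      have := mul_le_mul_of_nonneg_right hflux (show (0 : ℝ) ≤ Real.pi * ρ ^ 2 by positivity)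
      have eQ : Real.sqrt 2 * (a₁ + a₂ + a₃) * (Real.pi * ρ ^ 2) = (a₁ + a₂ + a₃) * Q := by rw [hQ]; ring
      linarith [eQ]
    have h2 : C₀ * ρ ≤ C₀ * (1 + h) * ρ := by
      have : 0 ≤ C₀ * h * ρ := by positivity
      linarith [show C₀ * (1 + h) * ρ = C₀ * ρ + C₀ * h * ρ by ring]
    have e4 : (2 / 3 * Real.sqrt 6 * s) * Real.pi * ρ ^ 2 = 2 / 3 * (Real.sqrt 6 * s * (Real.pi * ρ ^ 2)) := by ring
    rw [e4]
    linarith [h1, h2, hsum]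
  -- the payer assembly with budget `B`
  have hfin := hCpa h hh ρ hρ X P₁ P₂ hX hP₁X hP₂X₁ hcell hP₁ hP₂ (2 / 3 * Real.sqrt 6 * s) C₀ B hC₀0 hpay
  have e63 : 2 / 3 * Real.sqrt 6 * s / 2 = Real.sqrt 6 / 3 * s := by ring
  rw [e63] at hfin
  have eB : B / 2 = 1 / 2 * B := by ring
  linarith [hfin, eB]

end Summit.Ventures.Crystal3D.Theorems

end
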